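import Mathlib.Data.ZMod.Basic
import Mathlib.Data.Real.Basic
import Mathlib.Tactic
import HarnessLib

/-!
# Weil-type family coverage — the two Pell-type SIGN LEMMAS of the twisted obstruction: congruences at the
# split primes `3 = (4 + √13)(4 − √13)` and `7 = (3 + √2)(3 − √2)` force the unit `(U + V√d)/2` of `ℚ(√13)`
# resp. `ℚ(√2)` to be TOTALLY POSITIVE

research route conditional on HC_CM; not a corollary; Q11.4-sentence-2 already refuted in dim ≥ 3.

Ring 2, WEIL-TYPE FAMILY-COVERAGE CENSUS (`HOME/WEIL-FAMILY-COVERAGE.md` `## b01`, blocks b01.25 (A) and b01.38 (E)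
ROUTE NOTE; owner ring2-b01), part 32b of the `Ring2WeilCoverage*` series, companion of part 32
(`…SplitPrimeDescent`: at a split prime `π` of `ℤ[√d]`, a unit of `ℚ(√d)` that is a relative norm from the
ramified quadratic extension `ℚ(√d)(√(pγ))` reduces to a non-zero SQUARE modulo `π` and modulo `π̄`).  Here that
congruence information is converted into SIGNS — the only place where the unit group of the real quadratic field
enters, through an elementary Pell descent (no regulator, no class field theory, no PARI):

* `pos_add_mul_of_norm_pos`: `U > 0`, `U² − dV² > 0`, `ρ² = d` ⇒ `U + Vρ > 0` (positivity at BOTH real places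
  `√d ↦ ±ρ` of the element `(U + V√d)/2`).
* **Level `39` (`d = 13`, `p = 3`, `√13 ↦ ±4 ≡ ±1 (mod 3)`)**: `congr_thirteen` — if `2U + 2V` and `2U + 4V` are
  non-zero squares mod `3` then `U ≡ 2`, `V ≡ 0 (mod 3)`; `mod_three_of_pell_thirteen_pos` — every solution of
  `U² − 13V² = 4` with `U > 0`, `3 ∣ V` has `U ≡ 2 (mod 3)` (descent by `ε̄² = (11 − 3√13)/2`,
  `(U, V) ↦ ((11U − 117W)/2, (33W − 3U)/2)` for `V = 3W ≥ 3`); **`pos_of_pell_thirteen`**: `U² − 13V² = ±4`,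
  `U ≡ 2`, `V ≡ 0 (mod 3)` ⇒ `U > 0` and the sign is `+4`.
* **Level `56` (`d = 2`, `p = 7`, `√2 ↦ ±3`)**: `qr_seven_of_pell_two_pos` — every solution of `X² − 2Y² = 1` with
  `X > 0` has `X + 3Y`, `X + 4Y` non-zero squares mod `7` (descent by `3 − 2√2`); **`pos_of_pell_two`**:
  `U² − 2V² = ±4` with `2(U + 3V)`, `2(U + 4V)` non-zero squares mod `7` ⇒ `U > 0`, sign `+4` (the product of the
  two residues is `≡ U² − 2V²`, and `−4 ≡ 3` is a non-residue; on `X² − 2Y² = 1`, `(X + 3Y)(−X + 3Y) ≡ −1`).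

Consumer: part 33 (`…RelativeNormPositivity`).  HONEST FRAMING: elementary arithmetic (two Pell equations and
quadratic residues mod `3`, `7`); nothing here mentions Hodge classes, polarisations, `W_K` or HC; `HC_CM` is used
nowhere.  No `def`, no named fact, no `sorry`.  Seat-derived [folklore].
-/

namespace Summit.HodgeConjecture.Ring2WeilCoverage.SplitPrimePellSigns

/-! ### The sign lemmas: `d = 13, p = 3` (level `39`) and `d = 2, p = 7` (level `56`) -/

/-- Two reals with positive product and positive sum are both positive; applied: `U > 0`, `U² − dV² > 0`,
`ρ² = d` ⇒ `U + Vρ > 0` (the element `(U + V√d)/2` is positive at the real place `√d ↦ ρ`).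
research route conditional on HC_CM; not a corollary; Q11.4-sentence-2 already refuted in dim ≥ 3. [folklore] -/
theorem pos_add_mul_of_norm_pos {d : ℤ} {U V : ℤ} (hU : 0 < U) (hn : 0 < U ^ 2 - d * V ^ 2) {ρ : ℝ}
    (hρ : ρ ^ 2 = d) : 0 < (U : ℝ) + V * ρ := by
  have hprod : 0 < ((U : ℝ) + V * ρ) * ((U : ℝ) - V * ρ) := by
    have h1 : ((U : ℝ) + V * ρ) * ((U : ℝ) - V * ρ) = (U : ℝ) ^ 2 - d * V ^ 2 := by
      rw [← hρ]; ring
    rw [h1]; exact_mod_cast hn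
  have hsum : 0 < ((U : ℝ) + V * ρ) + ((U : ℝ) - V * ρ) := by
    have : ((U : ℝ) + V * ρ) + ((U : ℝ) - V * ρ) = 2 * U := by ring
    rw [this]; positivity
  by_contra h
  have h1 : (U : ℝ) + V * ρ ≤ 0 := not_lt.mp h
  have h2 : 0 < (U : ℝ) - V * ρ := by linarith
  nlinarith

/-- **Level `39`: the congruences.**  In `ℤ/3`, if `2U + 2V·1` and `2U + 2V·2` (the reductions of `2U + 2V√13`
at `√13 ↦ 4 ≡ 1` and `√13 ↦ −4 ≡ 2`) are both non-zero squares (i.e. both `= 1`), then `U ≡ 2` and `V ≡ 0`.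
research route conditional on HC_CM; not a corollary; Q11.4-sentence-2 already refuted in dim ≥ 3. [folklore] -/
theorem congr_thirteen {U V : ℤ}
    (h1 : IsSquare ((2 * U : ZMod 3) + (2 * V : ZMod 3) * 1) ∧ (2 * U : ZMod 3) + (2 * V : ZMod 3) * 1 ≠ 0)
    (h2 : IsSquare ((2 * U : ZMod 3) + (2 * V : ZMod 3) * 2) ∧ (2 * U : ZMod 3) + (2 * V : ZMod 3) * 2 ≠ 0) :
    (U : ZMod 3) = 2 ∧ (V : ZMod 3) = 0 := by
  have key : ∀ u v : ZMod 3, (IsSquare (2 * u + 2 * v * 1) ∧ 2 * u + 2 * v * 1 ≠ 0) →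
      (IsSquare (2 * u + 2 * v * 2) ∧ 2 * u + 2 * v * 2 ≠ 0) → u = 2 ∧ v = 0 := by decide
  exact key _ _ h1 h2

/-- **Level `39`: positive solutions of `U² − 13V² = 4` with `3 ∣ V` have `U ≡ 2 (mod 3)`** (descent by
`ε̄² = (11 − 3√13)/2`: `(U, V) ↦ ((11U − 39V)/2, (11V − 3U)/2)` for `V ≥ 3`; `V = 0` gives `U = 2`).
research route conditional on HC_CM; not a corollary; Q11.4-sentence-2 already refuted in dim ≥ 3. [folklore] -/
theorem mod_three_of_pell_thirteen_pos :
    ∀ n : ℕ, ∀ U V : ℤ, V.natAbs = n → U ^ 2 - 13 * V ^ 2 = 4 → 0 < U → (3 : ℤ) ∣ V → U % 3 = 2 := by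
  intro n
  induction n using Nat.strong_induction_on with
  | _ n ih =>
  intro U V hn hE hU h3
  -- reduce to `V ≥ 0`
  wlog hV0 : 0 ≤ V generalizing V
  · exact this (-V) (by rw [Int.natAbs_neg]; exact hn) (by linear_combination hE) (dvd_neg.mpr h3)
      (by omega)
  rcases hV0.eq_or_lt with hV | hV
  · -- `V = 0`: `U² = 4`, `U = 2`
    rw [← hV] at hE
    have hU2 : U = 2 := by nlinarith
    rw [hU2]; rfl
  · -- `V = 3W ≥ 3`; descend by `ε̄² = (11 − 3√13)/2`
    obtain ⟨W, rfl⟩ := h3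
    have hW : 1 ≤ W := by omega
    -- parity: `U ≡ W (mod 2)` from `U² − 117W² = 4`
    have hUW : (2 : ℤ) ∣ U - W := by
      have h1 : (2 : ℤ) ∣ (U - W) * (U + W) := ⟨2 + 58 * W ^ 2, by linear_combination hE⟩
      rcases Int.prime_two.dvd_or_dvd h1 with h | h
      · exact h
      · have e : U - W = (U + W) - 2 * W := by ring
        rw [e]; exact dvd_sub h (dvd_mul_right 2 W)
    obtain ⟨k, hk⟩ := hUW
    have hUk : U = W + 2 * k := by linear_combination hk
    -- the new solution `U' = (11U − 117W)/2 = 11k − 53W`, `V' = (33W − 3U)/2 = 15W − 3k`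
    have hE' : (11 * k - 53 * W) ^ 2 - 13 * (15 * W - 3 * k) ^ 2 = 4 := by
      rw [hUk] at hE; linear_combination hE
    have hU9 : 9 * W < U := by nlinarith
    have hU11 : U ≤ 11 * W := by nlinarith
    have hV'0 : 0 ≤ 15 * W - 3 * k := by omega
    have hV'lt : 15 * W - 3 * k < 3 * W := by omega
    have hU'pos : 0 < 11 * k - 53 * W := by nlinarith
    have h3V' : (3 : ℤ) ∣ 15 * W - 3 * k := ⟨5 * W - k, by ring⟩
    have hmod := ih (15 * W - 3 * k).natAbs (by rw [← hn]; omega) (11 * k - 53 * W) (15 * W - 3 * k) rfl hE'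
      hU'pos h3V'
    omega

/-- **Level `39`: the sign lemma.**  `U² − 13V² = ±4`, `U ≡ 2 (mod 3)`, `V ≡ 0 (mod 3)` ⇒ `U > 0` and
`U² − 13V² = 4` (`−4 ≡ 2 ≢ U² ≡ 1`; if `U < 0`, `−U` is a positive solution, so `−U ≡ 2`, i.e. `U ≡ 1`).  Hence the
unit `(U + V√13)/2` of `ℚ(√13)` is TOTALLY POSITIVE.
research route conditional on HC_CM; not a corollary; Q11.4-sentence-2 already refuted in dim ≥ 3. [folklore] -/
theorem pos_of_pell_thirteen {U V : ℤ} (hE : U ^ 2 - 13 * V ^ 2 = 4 ∨ U ^ 2 - 13 * V ^ 2 = -4)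
    (hU : (U : ZMod 3) = 2) (hV : (V : ZMod 3) = 0) : 0 < U ∧ U ^ 2 - 13 * V ^ 2 = 4 := by
  have h3V : (3 : ℤ) ∣ V := (ZMod.intCast_zmod_eq_zero_iff_dvd V 3).mp hV
  have hU3 : U % 3 = 2 := by
    have h1 : ((U - 2 : ℤ) : ZMod 3) = 0 := by push_cast; rw [hU]; ring
    have h2 := (ZMod.intCast_zmod_eq_zero_iff_dvd _ 3).mp h1
    omega
  have hE4 : U ^ 2 - 13 * V ^ 2 = 4 := by
    rcases hE with h | h
    · exact h
    · exfalso
      obtain ⟨W, rfl⟩ := h3V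
      have h1 : ((U ^ 2 - 13 * (3 * W) ^ 2 : ℤ) : ZMod 3) = ((-4 : ℤ) : ZMod 3) := by rw [h]
      push_cast at h1
      rw [hU, show (3 : ZMod 3) = 0 from rfl] at h1
      simp only [zero_mul, ne_eq, OfNat.ofNat_ne_zero, not_false_eq_true, zero_pow, mul_zero,
        sub_zero] at h1
      exact absurd h1 (by decide)
  refine ⟨?_, hE4⟩
  rcases lt_trichotomy U 0 with hneg | hzero | hpos
  · exfalso
    have h := mod_three_of_pell_thirteen_pos _ (-U) V rfl (by linear_combination hE4) (by omega) h3V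
    omega
  · exfalso; rw [hzero] at hE4; nlinarith
  · exact hpos

/-- **Level `56`: positive solutions of `X² − 2Y² = 1` have `X + 3Y` and `X + 4Y` non-zero squares mod `7`**
(descent by `3 − 2√2`: `(X, Y) ↦ (3X − 4Y, 3Y − 2X)` for `Y ≥ 2`; `Y = 1` is impossible, `Y = 0` gives `X = 1`;
the invariants transform by the squares `4` and `2`).
research route conditional on HC_CM; not a corollary; Q11.4-sentence-2 already refuted in dim ≥ 3. [folklore] -/
theorem qr_seven_of_pell_two_pos :
    ∀ n : ℕ, ∀ X Y : ℤ, Y.natAbs = n → X ^ 2 - 2 * Y ^ 2 = 1 → 0 < X →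
      (IsSquare ((X : ZMod 7) + 3 * (Y : ZMod 7)) ∧ (X : ZMod 7) + 3 * (Y : ZMod 7) ≠ 0) ∧
      (IsSquare ((X : ZMod 7) + 4 * (Y : ZMod 7)) ∧ (X : ZMod 7) + 4 * (Y : ZMod 7) ≠ 0) := by
  intro n
  induction n using Nat.strong_induction_on with
  | _ n ih =>
  intro X Y hn hE hX
  wlog hY0 : 0 ≤ Y generalizing Y
  · have h := this (-Y) (by rw [Int.natAbs_neg]; exact hn) (by linear_combination hE) (by omega)
    have key : ∀ x y : ZMod 7, ((IsSquare (x + 3 * -y) ∧ x + 3 * -y ≠ 0) ∧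
        (IsSquare (x + 4 * -y) ∧ x + 4 * -y ≠ 0)) →
        ((IsSquare (x + 3 * y) ∧ x + 3 * y ≠ 0) ∧ (IsSquare (x + 4 * y) ∧ x + 4 * y ≠ 0)) := by decide
    have h' := key (X : ZMod 7) (Y : ZMod 7)
    push_cast at h h'
    exact h' h
  rcases hY0.eq_or_lt with hY | hY
  · rw [← hY] at hE ⊢
    have hX1 : X = 1 := by nlinarith
    rw [hX1]; decide
  · have hY2 : 2 ≤ Y := by
      by_contra h
      have hY1 : Y = 1 := by omega
      rw [hY1] at hE
      have h3 : X ^ 2 = 3 := by linarith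
      have h5 : X < 2 := by nlinarith
      have h6 : 1 < X := by nlinarith
      omega
    set X' : ℤ := 3 * X - 4 * Y with hX'
    set Y' : ℤ := 3 * Y - 2 * X with hY'
    have hE' : X' ^ 2 - 2 * Y' ^ 2 = 1 := by rw [hX', hY']; linear_combination hE
    have hY'0 : 0 ≤ Y' := by nlinarith
    have hY'lt : Y' < Y := by nlinarith
    have hX'pos : 0 < X' := by nlinarith
    have h := ih Y'.natAbs (by rw [← hn]; omega) X' Y' rfl hE' hX'pos
    rw [hX', hY'] at h
    have key : ∀ x y : ZMod 7,
        ((IsSquare (3 * x - 4 * y + 3 * (3 * y - 2 * x)) ∧ 3 * x - 4 * y + 3 * (3 * y - 2 * x) ≠ 0) ∧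
          (IsSquare (3 * x - 4 * y + 4 * (3 * y - 2 * x)) ∧ 3 * x - 4 * y + 4 * (3 * y - 2 * x) ≠ 0)) →
        ((IsSquare (x + 3 * y) ∧ x + 3 * y ≠ 0) ∧ (IsSquare (x + 4 * y) ∧ x + 4 * y ≠ 0)) := by decide
    have h' := key (X : ZMod 7) (Y : ZMod 7)
    push_cast at h h'
    exact h' h

/-- **Level `56`: the sign lemma.**  `U² − 2V² = ±4` with `2(U + 3V)` and `2(U + 4V)` non-zero squares mod `7`
(the reductions of `2U + 2V√2` at `√2 ↦ 3` and `√2 ↦ −3 ≡ 4`) ⇒ `U > 0` and `U² − 2V² = 4` (the product of the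
two is `≡ U² − 2V²`, a square, and `−4 ≡ 3` is not; then `U = 2X`, `V = 2Y`, `X² − 2Y² = 1`, and a negative
`X` would make `−X − 3Y` a square, contradicting `X + 3Y ∈ (𝔽₇ˣ)²` — `−1` is a non-residue mod `7`).  Hence the
unit `(U + V√2)/2` of `ℚ(√2)` is TOTALLY POSITIVE.
research route conditional on HC_CM; not a corollary; Q11.4-sentence-2 already refuted in dim ≥ 3. [folklore] -/
theorem pos_of_pell_two {U V : ℤ} (hE : U ^ 2 - 2 * V ^ 2 = 4 ∨ U ^ 2 - 2 * V ^ 2 = -4)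
    (h1 : IsSquare ((2 * U : ZMod 7) + (2 * V : ZMod 7) * 3) ∧ (2 * U : ZMod 7) + (2 * V : ZMod 7) * 3 ≠ 0)
    (h2 : IsSquare ((2 * U : ZMod 7) + (2 * V : ZMod 7) * 4) ∧ (2 * U : ZMod 7) + (2 * V : ZMod 7) * 4 ≠ 0) :
    0 < U ∧ U ^ 2 - 2 * V ^ 2 = 4 := by
  have hE4 : U ^ 2 - 2 * V ^ 2 = 4 := by
    rcases hE with h | h
    · exact h
    · exfalso
      have key : ∀ u v : ZMod 7, (IsSquare (2 * u + 2 * v * 3) ∧ 2 * u + 2 * v * 3 ≠ 0) →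
          (IsSquare (2 * u + 2 * v * 4) ∧ 2 * u + 2 * v * 4 ≠ 0) → u ^ 2 - 2 * v ^ 2 ≠ -4 := by decide
      have h3 := key (U : ZMod 7) (V : ZMod 7)
      apply h3 h1 h2
      have h4 : ((U ^ 2 - 2 * V ^ 2 : ℤ) : ZMod 7) = ((-4 : ℤ) : ZMod 7) := by rw [h]
      push_cast at h4
      exact h4
  refine ⟨?_, hE4⟩
  -- `U, V` are even
  have hU2 : (2 : ℤ) ∣ U := by
    have h3 : (2 : ℤ) ∣ U ^ 2 := ⟨2 + V ^ 2, by linear_combination hE4⟩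
    exact Int.prime_two.dvd_of_dvd_pow h3
  obtain ⟨X, rfl⟩ := hU2
  have hV2 : (2 : ℤ) ∣ V := by
    have h3 : (2 : ℤ) ∣ V ^ 2 := ⟨X ^ 2 - 1, by have := hE4; ring_nf at this ⊢; linarith⟩
    exact Int.prime_two.dvd_of_dvd_pow h3
  obtain ⟨Y, rfl⟩ := hV2
  have hE1 : X ^ 2 - 2 * Y ^ 2 = 1 := by have := hE4; ring_nf at this ⊢; linarith
  rcases lt_trichotomy X 0 with hneg | hzero | hpos
  · exfalso
    have h := (qr_seven_of_pell_two_pos _ (-X) Y rfl (by linear_combination hE1) (by omega)).1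
    -- `(X + 3Y)(−X + 3Y) = 9Y² − X² ≡ 7Y² − 1 ≡ −1`, a non-residue: not both factors are residues
    have key : ∀ x y : ZMod 7, x ^ 2 - 2 * y ^ 2 = 1 →
        (IsSquare (2 * (2 * x) + 2 * (2 * y) * 3) ∧ 2 * (2 * x) + 2 * (2 * y) * 3 ≠ 0) →
        ¬ (IsSquare (-x + 3 * y) ∧ -x + 3 * y ≠ 0) := by decide
    have hE7 : (X : ZMod 7) ^ 2 - 2 * (Y : ZMod 7) ^ 2 = 1 := by
      have e : ((X ^ 2 - 2 * Y ^ 2 : ℤ) : ZMod 7) = ((1 : ℤ) : ZMod 7) := by rw [hE1]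
      push_cast at e
      exact e
    have h3 := key (X : ZMod 7) (Y : ZMod 7) hE7
    push_cast at h1 h h3
    exact h3 h1 h
  · exfalso; rw [hzero] at hE1; nlinarith
  · omega

end Summit.HodgeConjecture.Ring2WeilCoverage.SplitPrimePellSigns
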